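import Summits.Ventures.HodgeRepro.CosetQuadCore

/-!
# Route-2's Theorem F: the product-free class of `C₂ × A₄` (degree 24) — an instance on the kernel

Blind re-derivation cell `pub-hodge-repro`, seat `p1` (gen 12).  ROUTE-B §9.41 (route-2 g31, INBOX L1192, Theorem F):
the product-free class `F` of the degree-24 group `C₂ × A₄` — the one class of §9.36(a) that §9.39 left open — is
carried by the pointed sets `Δ(x, n) = {1, x, c n, c x⁻¹ n x²}` (`x` of order 3, `n ∈ V₄ ∖ 1`), with 12 instances on each.
This file puts ONE such instance on the kernel, on the group itself: the model `A4 = V₄ ⋊ C₃` (`V₄ = ℤ/2 × ℤ/2`, the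
generator of `C₃` acting by `(a, b) ↦ (b, a + b)`, Mathlib's `SemidirectProduct`) and `P = ℤ/2 × A4` with
`c = (1, 1)` are finite and decidable, and `exists_FQuad_on_C2xA4` exhibits a CM type `ΦF` of `(P, c)` whose twists by
`Δ(x, n₁)` are `SumTwo` without a conjugate pair — every condition decided on the 24 elements.  The witness is one of the
12 instances found by the seat's enumeration proofs/p1-g12/fwitness.py (all 4,096 CM types; the count 12 = route-2's).
Not claimed: the transport to arbitrary `(G, c) ⊇ C₂ × A₄` (the analogue of `TwistedQuad16.modelHom`), the other
23 pointed sets, the counts.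
-/

set_option autoImplicit false

open Finset Multiplicative
open scoped Pointwise

namespace HodgeRepro.TheoremF

open HodgeRepro.CosetQuad

/-- The Klein four-group `V₄ = ℤ/2 × ℤ/2` (multiplicative). -/
abbrev V4 : Type := Multiplicative (ZMod 2) × Multiplicative (ZMod 2)

/-- The automorphism `(a, b) ↦ (b, a b)` of `V₄`, of order 3. -/
def sigma : V4 ≃* V4 where
  toFun v := (v.2, v.1 * v.2)
  invFun v := (v.1 * v.2, v.1)
  left_inv := by decide
  right_inv := by decide
  map_mul' := by decide

/-- `sigma` has order 3. -/
theorem sigma_cube : sigma ^ 3 = 1 :=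
  MulEquiv.ext (by decide : ∀ v : V4, (sigma ^ 3) v = (1 : MulAut V4) v)

/-- The action `C₃ →* Aut(V₄)` sending the generator to `sigma`. -/
def phi3 : Multiplicative (ZMod 3) →* MulAut V4 := zmodPowHom 3 sigma sigma_cube

/-- The alternating group `A₄ = V₄ ⋊ C₃`. -/
abbrev A4 : Type := V4 ⋊[phi3] Multiplicative (ZMod 3)

/-- `A4` is a finite type (through the product of its two coordinates). -/
instance : Fintype A4 :=
  Fintype.ofEquiv (V4 × Multiplicative (ZMod 3))
    { toFun := fun p => ⟨p.1, p.2⟩, invFun := fun x => (x.left, x.right),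
      left_inv := fun _ => rfl, right_inv := fun _ => rfl }

/-- Equality on `A4` is decidable (coordinatewise). -/
instance : DecidableEq A4 := fun x y =>
  decidable_of_iff (x.left = y.left ∧ x.right = y.right)
    ⟨fun h => SemidirectProduct.ext h.1 h.2, fun h => ⟨congrArg _ h, congrArg _ h⟩⟩

/-- The degree-24 group `C₂ × A₄`. -/
abbrev C2xA4 : Type := Multiplicative (ZMod 2) × A4

/-- `A₄` has order 12. -/
theorem card_A4 : Fintype.card A4 = 12 := by decide

/-- `C₂ × A₄` has order 24. -/
theorem card_C2xA4 : Fintype.card C2xA4 = 24 := by decide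

/-- Complex conjugation `c = (1, 1)`, the central involution of `C₂ × A₄` outside `A₄`. -/
def cF : C2xA4 := (ofAdd 1, 1)

/-- The element `x = (0, (1, r))` of order 3. -/
def xF : C2xA4 := (1, SemidirectProduct.inr (ofAdd 1))

/-- The involution `n₁ = (0, ((1, 0), 1)) ∈ V₄`. -/
def n1F : C2xA4 := (1, SemidirectProduct.inl (ofAdd 1, ofAdd 0))

/-- `c` is a complex conjugation of `C₂ × A₄`. -/
theorem isComplexConj_cF : IsComplexConj cF := ⟨by decide, by decide, by decide⟩

/-- `x` has order 3. -/
theorem orderOf_xF : orderOf xF = 3 := by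
  rw [orderOf_eq_iff (by norm_num)]
  exact ⟨by decide, by decide⟩

/-- Route-2's pointed set `Δ(x, n₁) = {1, x, c n₁, c x⁻¹ n₁ x²}` as a quadruple of twists. -/
def tF : Fin 4 → C2xA4 := ![1, xF, cF * n1F, cF * xF⁻¹ * n1F * xF ^ 2]

/-- A CM type of `(C₂ × A₄, c)` carrying the `F` instance (one of route-2's 12 on `Δ(x, n₁)`); coordinates
`(e, ((a, b), r)) ↦ cᵉ n₁ᵃ n₂ᵇ xʳ`. -/
def ΦF : Finset C2xA4 :=
  {(ofAdd 0, ⟨(ofAdd 0, ofAdd 0), ofAdd 0⟩), (ofAdd 0, ⟨(ofAdd 0, ofAdd 0), ofAdd 1⟩),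
    (ofAdd 1, ⟨(ofAdd 0, ofAdd 0), ofAdd 2⟩), (ofAdd 0, ⟨(ofAdd 0, ofAdd 1), ofAdd 0⟩),
    (ofAdd 0, ⟨(ofAdd 0, ofAdd 1), ofAdd 1⟩), (ofAdd 1, ⟨(ofAdd 0, ofAdd 1), ofAdd 2⟩),
    (ofAdd 0, ⟨(ofAdd 1, ofAdd 0), ofAdd 0⟩), (ofAdd 1, ⟨(ofAdd 1, ofAdd 0), ofAdd 1⟩),
    (ofAdd 0, ⟨(ofAdd 1, ofAdd 0), ofAdd 2⟩), (ofAdd 0, ⟨(ofAdd 1, ofAdd 1), ofAdd 0⟩),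
    (ofAdd 1, ⟨(ofAdd 1, ofAdd 1), ofAdd 1⟩), (ofAdd 0, ⟨(ofAdd 1, ofAdd 1), ofAdd 2⟩)}

/-- `ΦF` is a CM type for `c`. -/
theorem isCMType_ΦF : IsCMType cF ΦF := by decide

/-- The twists of `ΦF` by `Δ(x, n₁)` are `SumTwo`. -/
theorem sumTwo_ΦF : SumTwo (fun i => rmul ΦF (tF i)) := by
  unfold SumTwo
  decide

/-- No two twists of `ΦF` by `Δ(x, n₁)` are complex conjugate. -/
theorem noConj_ΦF : ∀ i j : Fin 4, rmul ΦF (tF j) ≠ cF • rmul ΦF (tF i) := by decide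

/-- **Theorem F on `C₂ × A₄` (route-2 §9.41, kernel instance).**  Some CM type of `(C₂ × A₄, c)` has its twists by
`Δ(x, n₁) = {1, x, c n₁, c x⁻¹ n₁ x²}` `SumTwo` without a conjugate pair — the product-free degree-24 mechanism. -/
theorem exists_FQuad_on_C2xA4 : ∃ Φ : Finset C2xA4, IsCMType cF Φ ∧ SumTwo (fun i => rmul Φ (tF i)) ∧
    ∀ i j : Fin 4, rmul Φ (tF j) ≠ cF • rmul Φ (tF i) :=
  ⟨ΦF, isCMType_ΦF, sumTwo_ΦF, noConj_ΦF⟩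

end HodgeRepro.TheoremF
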